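import Literature.NumberTheory.GaloisCohomology.Howard2004.TowerSelmerLiftGlobalDualityProofs
import Literature.NumberTheory.GaloisCohomology.Howard2004.TransverseScalarStableProofs
import Literature.NumberTheory.GaloisCohomology.PairingTateDual
import Literature.NumberTheory.GaloisRepresentations.ContinuousCupProductCompat
import Literature.NumberTheory.GaloisRepresentations.GaloisCohomologyScalarActionLocalConditions
import HarnessLib

/-!
# Howard 2004, Prop. 1.4.1 — transposes `φ^D` of equivariant maps: adjunction with the local Tate pairings, functoriality
# of DUAL Selmer groups, and the `R`-BALANCE of the Poitou–Tate value of local defects (pairing-free) — proofs file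

Topic `NumberTheory/GaloisCohomology/Howard2004`. THEOREMS ONLY: no definition, no named fact, no instance, no notation,
no `sorry`.  Cell `pub/bsd-print-x9` (seat x10b-p1-w8 g12, bricks «C451-CL Q5 ADJ letters II / BAL-DUAL» of LEAD g14's class-level
port plan, `--supports stmt-BirchSwinnertonDyer-22642`; print leaf G87 ↦ the «Flach leaf» C45.1′ / C45.1″).  Sequel of
`TowerSelmerLiftGlobalDualityProofs` (LIFT-PT), `TowerSelmerLiftPairingWellDefinedProofs` (LIFT-WD) and
`TowerSelmerLiftPairingRightOrthogonalProofs` (Q5-DUAL).  The class-level Cassels–Tate value is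
`P(a)(y′) = ∑_{v ∈ Σ} inv_v(m_v ∪ loc_v y′)` for local defects `(m_v)` of a global lift `ã` of `a` and `y′` in the DUAL Selmer
group `H¹_{𝓕(n)_0^*}(K, T^{(0)*})`; two of its structural properties are reduced here to one GENERIC adjunction.

SOURCE. B. Howard, *The Heegner point Kolyvagin system*, Compositio Math. **140** (2004) = arXiv:1202.6340, Prop. 1.4.1 (p0008
L83–98: the pairing is one of `R`-modules) and Def. 1.1.6 / 1.1.10 (dual local conditions, p. 5–6); J. Milne, *Arithmetic Duality
Theorems* (2006), Ch. I §2 (`M^D`, Cor. 2.3); J. Neukirch, A. Schmidt, K. Wingberg, *Cohomology of Number Fields*, I §4 (1.4.2)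
(adjoint naturality of the cup product); A. Morgan, A. Smith, arXiv:2103.08530, §3 (functoriality of the pairing in the module).

WHAT IS PROVED.
* §1 GENERIC TRANSPOSE.  For discrete `Γ_K`-modules `M₁`, `M₂`, an equivariant additive `φ : M₁ → M₂` and a level `n₀`, the
  pairing `B_φ := (x, f) ↦ f(φ x) : M₁ × M₂^D → μ_{n₀}` is equivariant (`pairing_comp_smul`), so the tree's
  `pairingDualHom n₀ B_φ : M₂^D → M₁^D` — the TRANSPOSE `φ^D = (f ↦ f ∘ φ)` — is equivariant (`pairingDualHom_smul`), and
  **`localTatePairing_cohomologyMap_transpose`**: `⟨m, H¹_v(φ^D) y⟩_{M₁} = ⟨H¹_v(φ) m, y⟩_{M₂}` at every place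
  (`ContPairing.cupProduct_adjoint`); summed with local invariants: `sum_localTatePairingZMod_cohomologyMap_transpose_eq`.
* §2 DUAL SELMER FUNCTORIALITY.  **`cohomologyMap_transpose_mem_selmerGroup_dual`**: if `H¹_v(φ)` carries `𝓛₁,v` into `𝓛₂,v`
  at every place, then `H¹(φ^D)` carries `H¹_{𝓛₂^*}(K, M₂^D)` into `H¹_{𝓛₁^*}(K, M₁^D)` (orthogonal complements, by §1).
* §3 ON A `DVRSetting` (levels `0`, `t+1`, `ι : T^{(0)} → T^{(t+1)}` as in LIFT-PT; a scalar `r ∈ R` acting as the equivariant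
  endomorphism `r•` of `T^{(k)}`, whose transpose is `r^D`):
  - `cohomologyMap_transpose_mem_dualSelmerGroup_atLevel` — `H¹(ι^D)` maps `H¹_{𝓕(n)_{t+1}^*}` into `H¹_{𝓕(n)_0^*}` (given
    `H¹_v(ι) 𝓕(n)_{0,v} ⊆ 𝓕(n)_{t+1,v}`), so the value of Q5-DUAL is taken AT a dual-Selmer class of level `0`;
  - `scalarTranspose_mem_dualSelmerGroup_atLevel` — `H¹(r^D)` preserves `H¹_{𝓕(n)_k^*}(K, T^{(k)*})` (`𝓕(n)` is `R`-stable);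
  - **`localDefects_smul`** — if `(m_v)` are local defects of `ã` then `(r • m_v)` are local defects of `r • ã`
    (`loc`, `H¹(ι)` commute with `H¹(r•)`; `𝓕(n)_{t+1,v}` is an `R`-submodule; the support is kept since `r • 0 = 0`);
  - **`sum_localTatePairingZMod_defects_smul_eq`** — `∑_{v ∈ Σ} inv_v((r • m_v) ∪ loc_v y′) = ∑_{v ∈ Σ} inv_v(m_v ∪ loc_v(H¹(r^D) y′))`:
    the `R`-BALANCE `P(r • a)(y′) = P(a)(r^D y′)` of the class-level value, pairing-free.

HONEST FRAMING: no pairing is constructed; Prop. 1.4.1, C45.1′/C45.1″ and `thm161_dvrKolyvaginBound` are NOT proved; no summit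
statement is proved; the Birch–Swinnerton-Dyer conjecture is not proved by any of this.
-/

set_option autoImplicit false

noncomputable section

namespace Literature.NumberTheory.GaloisCohomology.Howard2004

open Function NumberField IsDedekindDomain Field CategoryTheory
open scoped NumberField ContRepresentation
open Literature.NumberTheory.GaloisRepresentations
open Literature.NumberTheory.GaloisRepresentations.DiscreteGaloisModule
open Literature.NumberTheory.GaloisCohomology (LocalInvariants)

/-! ## §1 The transpose `φ^D` of an equivariant map and its adjunction with the local Tate pairings (generic) -/

section Generic

variable {K : Type} [Field K] [NumberField K]
  {M₁ : Type} [AddCommGroup M₁] [TopologicalSpace M₁] [DiscreteTopology M₁] [Finite M₁]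
  {M₂ : Type} [AddCommGroup M₂] [TopologicalSpace M₂] [DiscreteTopology M₂] [Finite M₂]

omit [NumberField K] [Finite M₁] in
/-- **The pairing `B_φ(x, f) = f(φ x) : M₁ × M₂^D → μ_{n₀}` of an equivariant `φ : M₁ → M₂` is `Γ_K`-equivariant** (evaluation
is, and `φ` intertwines). [cite: MilneADT2006, Ch. I §2 (M^D and the evaluation pairing)] -/
theorem pairing_comp_smul (τ₁ : DiscreteGaloisModule K M₁) (τ₂ : DiscreteGaloisModule K M₂) (n₀ : ℕ) (φ : M₁ →+ M₂)
    (hφ : ∀ (g : absoluteGaloisGroup K) (x : M₁), φ (τ₁ g x) = τ₂ g (φ x))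
    (σ : absoluteGaloisGroup K) (x : M₁) (f : TateDual K M₂ n₀) :
    ((tateDualEval K M₂ n₀).comp φ) (τ₁ σ x) (τ₂.tateDual n₀ σ f) = mu K n₀ σ (((tateDualEval K M₂ n₀).comp φ) x f) := by
  rw [AddMonoidHom.comp_apply, AddMonoidHom.comp_apply, hφ]
  exact tateDualEval_smul τ₂ n₀ σ (φ x) f

/-- **Adjunction of the transpose with the local Tate pairings.**  For an equivariant `φ : M₁ → M₂` with transpose
`φ^D = pairingDualHom n₀ B_φ : M₂^D → M₁^D` (`(φ^D f)(x) = f(φ x)`), at every place `v`, for `m ∈ H¹(K_v, M₁)` and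
`y ∈ H¹(K_v, M₂^D)`: `⟨m, H¹_v(φ^D) y⟩_{M₁} = ⟨H¹_v(φ) m, y⟩_{M₂}` in `H²(K_v, μ_{n₀})` (adjoint naturality of the cup product).
[cite: NeukirchSchmidtWingberg2008, I §4 (1.4.2)] [cite: MilneADT2006, Ch. I Cor. 2.3] -/
theorem localTatePairing_cohomologyMap_transpose (τ₁ : DiscreteGaloisModule K M₁) (τ₂ : DiscreteGaloisModule K M₂)
    (n₀ : ℕ) (φ : M₁ →+ M₂) (hφ : ∀ (g : absoluteGaloisGroup K) (x : M₁), φ (τ₁ g x) = τ₂ g (φ x))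
    (v : Place K) (m : galoisCohomology (τ₁.toLocal v) 1) (y : galoisCohomology ((τ₂.tateDual n₀).toLocal v) 1) :
    localTatePairing τ₁ n₀ v m
        (ContinuousRep.cohomologyMap ((τ₂.tateDual n₀).toLocal v) ((τ₁.tateDual n₀).toLocal v)
          (pairingDualHom n₀ ((tateDualEval K M₂ n₀).comp φ)) continuous_of_discreteTopology
          (fun _ f => pairingDualHom_smul (pairing_comp_smul τ₁ τ₂ n₀ φ hφ) _ f) 1 y) =
      localTatePairing τ₂ n₀ v
        (ContinuousRep.cohomologyMap (τ₁.toLocal v) (τ₂.toLocal v) φ continuous_of_discreteTopology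
          (fun _ x => hφ _ x) 1 m) y := by
  haveI : CompactSpace (absoluteGaloisGroup (Place.Completion v)) := absoluteGaloisGroup_compactSpace _
  have h := ContPairing.cupProduct_adjoint (tateDualPairingLocal τ₁ n₀ v) (tateDualPairingLocal τ₂ n₀ v)
    (TopRep.ofHom ⟨⟨φ.toIntLinearMap, continuous_of_discreteTopology⟩, fun g => ContinuousLinearMap.ext fun x => hφ _ x⟩)
    (TopRep.ofHom ⟨⟨(pairingDualHom n₀ ((tateDualEval K M₂ n₀).comp φ)).toIntLinearMap, continuous_of_discreteTopology⟩,
      fun g => ContinuousLinearMap.ext fun f => pairingDualHom_smul (pairing_comp_smul τ₁ τ₂ n₀ φ hφ) _ f⟩)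
    (fun _ _ => rfl) m y
  exact h.symm

/-- **The adjunction, with local invariants and summed over a finite set of places**: for local classes `m_v ∈ H¹(K_v, M₁)` and a
GLOBAL `y ∈ H¹(K, M₂^D)`, `∑_{v ∈ Σ} inv_v(m_v ∪ loc_v(H¹(φ^D) y)) = ∑_{v ∈ Σ} inv_v(H¹_v(φ) m_v ∪ loc_v y)`
(localisation commutes with `H¹(φ^D)`). [cite: NeukirchSchmidtWingberg2008, I §4 (1.4.2)] [cite: MilneADT2006, Ch. I Cor. 2.3] -/
theorem sum_localTatePairingZMod_cohomologyMap_transpose_eq (τ₁ : DiscreteGaloisModule K M₁)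
    (τ₂ : DiscreteGaloisModule K M₂) (n₀ : ℕ) (φ : M₁ →+ M₂)
    (hφ : ∀ (g : absoluteGaloisGroup K) (x : M₁), φ (τ₁ g x) = τ₂ g (φ x))
    (inv : LocalInvariants K n₀) (Sfin : Finset (Place K)) (m : ∀ v : Place K, galoisCohomology (τ₁.toLocal v) 1)
    (y : galoisCohomology (τ₂.tateDual n₀) 1) :
    ∑ v ∈ Sfin, localTatePairingZMod τ₁ n₀ v (inv v) (m v)
        (galoisCohomology.localization (τ₁.tateDual n₀) v 1
          (ContinuousRep.cohomologyMap (τ₂.tateDual n₀) (τ₁.tateDual n₀)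
            (pairingDualHom n₀ ((tateDualEval K M₂ n₀).comp φ)) continuous_of_discreteTopology
            (pairingDualHom_smul (pairing_comp_smul τ₁ τ₂ n₀ φ hφ)) 1 y)) =
      ∑ v ∈ Sfin, localTatePairingZMod τ₂ n₀ v (inv v)
        (ContinuousRep.cohomologyMap (τ₁.toLocal v) (τ₂.toLocal v) φ continuous_of_discreteTopology
          (fun _ x => hφ _ x) 1 (m v))
        (galoisCohomology.localization (τ₂.tateDual n₀) v 1 y) := by
  refine Finset.sum_congr rfl fun v _ => ?_
  rw [localTatePairingZMod_apply, localTatePairingZMod_apply, localization_cohomologyMap_one,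
    localTatePairing_cohomologyMap_transpose τ₁ τ₂ n₀ φ hφ v]

/-! ## §2 Dual Selmer groups are functorial along transposes -/

/-- **Functoriality of DUAL Selmer groups along the transpose.**  If `H¹_v(φ)` carries the local condition `𝓛₁,v ≤ H¹(K_v, M₁)`
into `𝓛₂,v ≤ H¹(K_v, M₂)` at every place, then `H¹(φ^D) : H¹(K, M₂^D) → H¹(K, M₁^D)` carries the dual Selmer group
`H¹_{𝓛₂^*}(K, M₂^D)` into `H¹_{𝓛₁^*}(K, M₁^D)`: for `a ∈ 𝓛₁,v`, `⟨a, (φ^D y)_v⟩_v = ⟨H¹_v(φ) a, y_v⟩_v = 0`.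
[cite: Howard2004HeegnerKolyvagin, Def. 1.1.6 and Def. 1.1.10 (arXiv:1202.6340 Def. 2.1.6 / 2.1.10, p. 5–6)]
[cite: MilneADT2006, Ch. I Cor. 2.3] -/
theorem cohomologyMap_transpose_mem_selmerGroup_dual (τ₁ : DiscreteGaloisModule K M₁) (τ₂ : DiscreteGaloisModule K M₂)
    {n₀ : ℕ} (φ : M₁ →+ M₂) (hφ : ∀ (g : absoluteGaloisGroup K) (x : M₁), φ (τ₁ g x) = τ₂ g (φ x))
    (inv : LocalInvariants K n₀) (𝓛₁ : SelmerStructure τ₁) (𝓛₂ : SelmerStructure τ₂)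
    (hφL : ∀ (v : Place K) (x : galoisCohomology (τ₁.toLocal v) 1), x ∈ 𝓛₁ v →
      ContinuousRep.cohomologyMap (τ₁.toLocal v) (τ₂.toLocal v) φ continuous_of_discreteTopology
        (fun _ x => hφ _ x) 1 x ∈ 𝓛₂ v)
    {y : galoisCohomology (τ₂.tateDual n₀) 1} (hy : y ∈ (inv.dualSelmerStructure τ₂ 𝓛₂).selmerGroup) :
    ContinuousRep.cohomologyMap (τ₂.tateDual n₀) (τ₁.tateDual n₀)
        (pairingDualHom n₀ ((tateDualEval K M₂ n₀).comp φ)) continuous_of_discreteTopology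
        (pairingDualHom_smul (pairing_comp_smul τ₁ τ₂ n₀ φ hφ)) 1 y ∈
      (inv.dualSelmerStructure τ₁ 𝓛₁).selmerGroup := by
  rw [SelmerStructure.mem_selmerGroup_iff] at hy
  refine (SelmerStructure.mem_selmerGroup_iff _ _).2 fun v => ?_
  rw [LocalInvariants.dualSelmerStructure_apply, LocalInvariants.mem_dualLocalCondition_iff]
  intro a ha
  rw [localTatePairingZMod_apply, localization_cohomologyMap_one,
    localTatePairing_cohomologyMap_transpose τ₁ τ₂ n₀ φ hφ v, ← localTatePairingZMod_apply]
  exact (LocalInvariants.mem_dualLocalCondition_iff _ _ _ _ _).1 (hy v) _ (hφL v a ha)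

end Generic

/-! ## §3 On a `DVRSetting`: the tower inclusion `ι`, the scalars `r ∈ R`, local defects and the `R`-balance -/

namespace DVRSetting

variable {p : ℕ} [Fact p.Prime] {K : Type} [Field K] [NumberField K]
  {R : Type} [CommRing R] [IsDomain R] [IsDiscreteValuationRing R] [Algebra ℤ_[p] R]
  {N : ℕ → Type} [∀ k, AddCommGroup (N k)] [∀ k, TopologicalSpace (N k)]
  [∀ k, DiscreteTopology (N k)] [∀ k, Module R (N k)]
  {Rk : ℕ → Type} [∀ k, CommRing (Rk k)] [∀ k, IsLocalRing (Rk k)] [∀ k, TopologicalSpace (Rk k)]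
  [∀ k, DiscreteTopology (Rk k)] [∀ k, Algebra ℤ_[p] (Rk k)] [∀ k, Algebra R (Rk k)]
  [∀ k, Module (Rk k) (N k)] [∀ k, IsScalarTower R (Rk k) (N k)]
  {Nbar : Type} [AddCommGroup Nbar] [TopologicalSpace Nbar] [DiscreteTopology Nbar]
  [∀ k, Module (Rk k) Nbar]
  {Nq : ℕ → Finset (HeightOneSpectrum (𝓞 K)) → Type} [∀ k n, AddCommGroup (Nq k n)]
  [∀ k n, TopologicalSpace (Nq k n)] [∀ k n, DiscreteTopology (Nq k n)]
  [∀ k n, Module (Rk k) (Nq k n)] [∀ k n, Module R (Nq k n)]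
  [∀ k n, IsScalarTower R (Rk k) (Nq k n)]

/-- **`H¹(ι^D)` carries the dual Selmer group of level `t + 1` into the dual Selmer group of level `0`.**  For
`ι : T^{(0)} → T^{(t+1)}` equivariant with `H¹_v(ι) 𝓕(n)_{0,v} ⊆ 𝓕(n)_{t+1,v}` at every place (LIFT-PT's `hιF`, one direction),
`y′ ∈ H¹_{𝓕(n)_{t+1}^*}(K, T^{(t+1)*}) ⟹ H¹(ι^D) y′ ∈ H¹_{𝓕(n)_0^*}(K, T^{(0)*})` — so the Poitou–Tate value of local defects
(LIFT-PT / Q5-DUAL) is evaluated AT a level-`0` dual Selmer class.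
[cite: Howard2004HeegnerKolyvagin, Prop. 1.4.1 (arXiv:1202.6340 p0008 L83–98), Def. 1.1.6 / 1.1.10] [cite: MilneADT2006, Ch. I Cor. 2.3] -/
theorem cohomologyMap_transpose_mem_dualSelmerGroup_atLevel [∀ k, Finite (N k)] (S : DVRSetting p K R N Rk Nbar Nq)
    {t : ℕ} (n : Finset (HeightOneSpectrum (𝓞 K))) (ι : N 0 →ₗ[R] N (t + 1))
    (hιg : ∀ (g : absoluteGaloisGroup K) (x : N 0), ι (S.T.ρ 0 g x) = S.T.ρ (t + 1) g (ι x))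
    {n₀ : ℕ} (inv : LocalInvariants K n₀)
    (hιF : ∀ (v : Place K) (m : galoisCohomology ((S.T.ρ 0).toLocal v) 1), m ∈ ((S.t 0).atLevel S.jbar n).cond v →
      ContinuousRep.cohomologyMap ((S.T.ρ 0).toLocal v) ((S.T.ρ (t + 1)).toLocal v) ι.toAddMonoidHom
        continuous_of_discreteTopology (fun _ x => hιg _ x) 1 m ∈ ((S.t (t + 1)).atLevel S.jbar n).cond v)
    {y' : galoisCohomology ((S.T.ρ (t + 1)).tateDual n₀) 1}
    (hy' : y' ∈ (inv.dualSelmerStructure (S.T.ρ (t + 1)) ((S.t (t + 1)).atLevel S.jbar n).cond).selmerGroup) :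
    ContinuousRep.cohomologyMap ((S.T.ρ (t + 1)).tateDual n₀) ((S.T.ρ 0).tateDual n₀)
        (pairingDualHom n₀ ((tateDualEval K (N (t + 1)) n₀).comp ι.toAddMonoidHom)) continuous_of_discreteTopology
        (pairingDualHom_smul (pairing_comp_smul (S.T.ρ 0) (S.T.ρ (t + 1)) n₀ ι.toAddMonoidHom hιg)) 1 y' ∈
      (inv.dualSelmerStructure (S.T.ρ 0) ((S.t 0).atLevel S.jbar n).cond).selmerGroup :=
  cohomologyMap_transpose_mem_selmerGroup_dual (S.T.ρ 0) (S.T.ρ (t + 1)) ι.toAddMonoidHom hιg inv _ _ hιF hy'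

/-- **The local conditions of `𝓕(n)` on a level are `R`-submodules** (H: `cond_smul`, and Howard's transverse conditions are
`R`-stable): `𝓕(n)_k` is scalar-stable. [cite: Howard2004HeegnerKolyvagin, Def. 1.1.1, Def. 1.1.10 and Def. 1.2.2 (arXiv p. 5 L20–24, p. 6 L14–24, L101–125)] -/
theorem scalarMapH1_mem_cond_atLevel (S : DVRSetting p K R N Rk Nbar Nq) (hy : S.SatisfiesH) (k : ℕ)
    (n : Finset (HeightOneSpectrum (𝓞 K))) (r : R) (v : Place K) {x : galoisCohomology ((S.T.ρ k).toLocal v) 1}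
    (hx : x ∈ ((S.t k).atLevel S.jbar n).cond v) :
    galoisCohomology.scalarMapH1 ((S.T.ρ k).toLocal v) ((S.T.hlin k).restrictField (Place.Completion v)) r x ∈
      ((S.t k).atLevel S.jbar n).cond v := by
  have hc : (S.t k).cond.IsScalarStable (S.T.hlin k) := fun v r x hx => hy.cond_smul k v r ⟨x, hx, rfl⟩
  have htr : (transverseStructure p (S.T.ρ k) S.jbar).IsScalarStable (S.T.hlin k) :=
    isScalarStable_transverseStructure p (S.T.hlin k) S.jbar
  exact SelmerStructure.IsScalarStable.modify (S.T.hlin k) hc htr ∅ ∅ n v r hx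

/-- **`H¹(r^D)` preserves the dual Selmer group `H¹_{𝓕(n)_k^*}(K, T^{(k)*})`** of a level, `r^D` the transpose of the
equivariant endomorphism `r•` of `T^{(k)}` (the conditions of `𝓕(n)` are `R`-submodules, so are their orthogonal complements).
[cite: Howard2004HeegnerKolyvagin, Def. 1.1.6 / 1.1.10 (arXiv Def. 2.1.6 / 2.1.10) and Prop. 1.4.1] [cite: MilneADT2006, Ch. I Cor. 2.3] -/
theorem scalarTranspose_mem_dualSelmerGroup_atLevel [∀ k, Finite (N k)] (S : DVRSetting p K R N Rk Nbar Nq)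
    (hy : S.SatisfiesH) (k : ℕ) (n : Finset (HeightOneSpectrum (𝓞 K))) (r : R) {n₀ : ℕ} (inv : LocalInvariants K n₀)
    {y' : galoisCohomology ((S.T.ρ k).tateDual n₀) 1}
    (hy' : y' ∈ (inv.dualSelmerStructure (S.T.ρ k) ((S.t k).atLevel S.jbar n).cond).selmerGroup) :
    ContinuousRep.cohomologyMap ((S.T.ρ k).tateDual n₀) ((S.T.ρ k).tateDual n₀)
        (pairingDualHom n₀ ((tateDualEval K (N k) n₀).comp (DistribSMul.toAddMonoidHom (N k) r)))
        continuous_of_discreteTopology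
        (pairingDualHom_smul (pairing_comp_smul (S.T.ρ k) (S.T.ρ k) n₀ (DistribSMul.toAddMonoidHom (N k) r)
          (fun g y => (S.T.hlin k g r y).symm))) 1 y' ∈
      (inv.dualSelmerStructure (S.T.ρ k) ((S.t k).atLevel S.jbar n).cond).selmerGroup :=
  cohomologyMap_transpose_mem_selmerGroup_dual (S.T.ρ k) (S.T.ρ k) _ (fun g y => (S.T.hlin k g r y).symm) inv _ _
    (fun v _ hx => S.scalarMapH1_mem_cond_atLevel hy k n r v hx) hy'

/-- **Local defects are `R`-linear: if `(m_v)` are local defects of `ã`, then `(r • m_v)` are local defects of `r • ã`.**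
From `loc_v ã - ℓ_v = H¹_v(ι) m_v` with `ℓ_v ∈ 𝓕(n)_{t+1,v}`: `loc_v(r • ã) - r • ℓ_v = r • H¹_v(ι) m_v = H¹_v(ι)(r • m_v)`
(localisation and `H¹(ι)` commute with `H¹(r•)`, `ι` being `R`-linear), and `r • ℓ_v ∈ 𝓕(n)_{t+1,v}` (an `R`-submodule).
[cite: Howard2004HeegnerKolyvagin, Prop. 1.4.1 (arXiv:1202.6340 p0008 L83–98: a pairing of `R`-modules), Def. 1.1.1]
[cite: SerreGaloisCohomology1997, Ch. I §2.4 (compatible pairs)] -/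
theorem localDefects_smul (S : DVRSetting p K R N Rk Nbar Nq) (hy : S.SatisfiesH) {t : ℕ}
    (n : Finset (HeightOneSpectrum (𝓞 K))) (ι : N 0 →ₗ[R] N (t + 1))
    (hιg : ∀ (g : absoluteGaloisGroup K) (x : N 0), ι (S.T.ρ 0 g x) = S.T.ρ (t + 1) g (ι x)) (r : R)
    (ã : galoisCohomology (S.T.ρ (t + 1)) 1) (m : ∀ v : Place K, galoisCohomology ((S.T.ρ 0).toLocal v) 1)
    (hm : ∀ v, ∃ ℓ ∈ ((S.t (t + 1)).atLevel S.jbar n).cond v,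
      galoisCohomology.localization (S.T.ρ (t + 1)) v 1 ã - ℓ =
        ContinuousRep.cohomologyMap ((S.T.ρ 0).toLocal v) ((S.T.ρ (t + 1)).toLocal v) ι.toAddMonoidHom
          continuous_of_discreteTopology (fun _ x => hιg _ x) 1 (m v)) (v : Place K) :
    ∃ ℓ ∈ ((S.t (t + 1)).atLevel S.jbar n).cond v,
      galoisCohomology.localization (S.T.ρ (t + 1)) v 1 (galoisCohomology.scalarMapH1 (S.T.ρ (t + 1)) (S.T.hlin (t + 1)) r ã) - ℓ =
        ContinuousRep.cohomologyMap ((S.T.ρ 0).toLocal v) ((S.T.ρ (t + 1)).toLocal v) ι.toAddMonoidHom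
          continuous_of_discreteTopology (fun _ x => hιg _ x) 1
          (galoisCohomology.scalarMapH1 ((S.T.ρ 0).toLocal v) ((S.T.hlin 0).restrictField _) r (m v)) := by
  obtain ⟨ℓ, hℓ, hℓeq⟩ := hm v
  refine ⟨galoisCohomology.scalarMapH1 ((S.T.ρ (t + 1)).toLocal v) ((S.T.hlin (t + 1)).restrictField _) r ℓ,
    S.scalarMapH1_mem_cond_atLevel hy (t + 1) n r v hℓ, ?_⟩
  rw [galoisCohomology.localization_scalarMapH1, ← map_sub, hℓeq]
  exact (cohomologyMap_scalarMapH1 ((S.T.hlin 0).restrictField _) ((S.T.hlin (t + 1)).restrictField _) ι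
    (fun g x => hιg _ x) r (m v)).symm

/-- **The `R`-BALANCE of the Poitou–Tate value of local defects (pairing-free).**  For local classes `m_v ∈ H¹(K_v, T^{(0)})`,
a finite set of places `Σ` and a GLOBAL `y′ ∈ H¹(K, T^{(0)*})`:
`∑_{v ∈ Σ} inv_v((r • m_v) ∪ loc_v y′) = ∑_{v ∈ Σ} inv_v(m_v ∪ loc_v(H¹(r^D) y′))`, `r^D` the transpose of `r•` on `T^{(0)}`.
With `localDefects_smul` (defects of `r • ã` are `r • m_v`) and the lift/defect-independence of the value (LIFT-WD) this is
`P(r • a)(y′) = P(a)(r^D y′)` for the class-level Cassels–Tate value `P` — Howard's «pairing of `R`-modules».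
[cite: Howard2004HeegnerKolyvagin, Prop. 1.4.1 (arXiv:1202.6340 p0008 L83–98)] [cite: NeukirchSchmidtWingberg2008, I §4 (1.4.2)]
[cite: MilneADT2006, Ch. I Cor. 2.3] -/
theorem sum_localTatePairingZMod_defects_smul_eq [∀ k, Finite (N k)] (S : DVRSetting p K R N Rk Nbar Nq) (r : R)
    {n₀ : ℕ} (inv : LocalInvariants K n₀) (Sfin : Finset (Place K))
    (m : ∀ v : Place K, galoisCohomology ((S.T.ρ 0).toLocal v) 1) (y' : galoisCohomology ((S.T.ρ 0).tateDual n₀) 1) :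
    ∑ v ∈ Sfin, localTatePairingZMod (S.T.ρ 0) n₀ v (inv v)
        (galoisCohomology.scalarMapH1 ((S.T.ρ 0).toLocal v) ((S.T.hlin 0).restrictField _) r (m v))
        (galoisCohomology.localization ((S.T.ρ 0).tateDual n₀) v 1 y') =
      ∑ v ∈ Sfin, localTatePairingZMod (S.T.ρ 0) n₀ v (inv v) (m v)
        (galoisCohomology.localization ((S.T.ρ 0).tateDual n₀) v 1
          (ContinuousRep.cohomologyMap ((S.T.ρ 0).tateDual n₀) ((S.T.ρ 0).tateDual n₀)
            (pairingDualHom n₀ ((tateDualEval K (N 0) n₀).comp (DistribSMul.toAddMonoidHom (N 0) r)))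
            continuous_of_discreteTopology
            (pairingDualHom_smul (pairing_comp_smul (S.T.ρ 0) (S.T.ρ 0) n₀ (DistribSMul.toAddMonoidHom (N 0) r)
              (fun g y => (S.T.hlin 0 g r y).symm))) 1 y')) := by
  rw [sum_localTatePairingZMod_cohomologyMap_transpose_eq (S.T.ρ 0) (S.T.ρ 0) n₀ (DistribSMul.toAddMonoidHom (N 0) r)
    (fun g y => (S.T.hlin 0 g r y).symm) inv Sfin m y']
  rfl

end DVRSetting

end Literature.NumberTheory.GaloisCohomology.Howard2004

end
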